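import Summits.Ventures.PercRepro.C025ProfilePLDTwoFlat
import Summits.Ventures.PercRepro.C025ProfilePLDSymCounterexample
import Summits.Ventures.PercRepro.C025ProfilePLDClosureCorollaries
import Summits.Ventures.PercRepro.C025ProfilePLDRankThree

/-!
# PER-LAYER DOMINANCE FOR «RANK ≤ 3 ⊕ A TRIANGLE»: THE FIRST DIRECT-SUM CASE BEYOND THE CLOSURE SYSTEM (night-3 g30)

`proofs/NIGHT3-G30-PAREXT.md` §9.  For a matroid `M` of rank `≤ 3` the symmetric-coordinate certificates of g29's kind DO exist
(the obstruction of `PLDSymCex` starts at rank 6 for `Q₂` and rank 7 for the triangle): every canonical instance `(lo, hi, δ)`,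
`lo ≤ hi ≤ 5`, `δ ≤ 5`, of (PLD) on `M ⊕ U_{2,3}` is a nonnegative combination of the FOUR instances `(0,0,1,0)`, `(0,1,1,0)`,
`(0,0,2,0)`, `(1,1,1,3)` of (PLD)(M) plus nonnegativity, after symmetrisation by the complement `I ↦ E ∖ I` — a table of integer
multipliers (exact rational simplex, lab/cert3_table.py) verified POINTWISE on the 16 rank pairs `(x, f) ∈ [0,3]²` by `decide`
(`triangle_cert_table`).  THE CERTIFICATE LEMMA `target_of_cert` turns such a pointwise certificate into the target inequality
for any finite matroid of rank `≤ R` (sum over `I ⊆ E`, `PLDClosure.sum_complement` for the symmetrisation, the four (PLD)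
instances of `M`).  Result: `pld_disjointSum_triangle` — (PLD) for `M ⊕ U_{2,3}` whenever `M` has rank `≤ 3` and (PLD) (every
rank `≤ 3` matroid does, `PLDParExt.pld_of_eRank_le_three`), hence C-025 at every `(p, q)` on every truncation of
`(N₃ ⊕ U_{2,3}) ⊕ free points` (`rls_truncate_disjointSum_triangle_freeOn_of_eRank_le_three`).  The bounded-parameter
reduction `PLDSymCex.pld_of_bounded` (R = 5 for the sum) makes the table finite.  No `def`, no `instance`, no notation.
Axioms: standard.
-/

open scoped Matroid

namespace PercRepro

open Finset ThmH

namespace PLDTriangle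

variable {α : Type} [DecidableEq α]

omit [DecidableEq α] in
/-- ranks are bounded by the rank of the matroid, in `ℕ` -/
theorem toNat_eRk_le_of_eRank_le (M : Matroid α) {R : ℕ} (h : M.eRank ≤ R) (X : Set α) : (M.eRk X).toNat ≤ R :=
  ENat.toNat_le_of_le_coe ((M.eRk_le_eRank X).trans h)

/-- THE CERTIFICATE LEMMA: a target inequality `Σ_I tL(ρI, ρ(E∖I)) ≤ Σ_I tR(ρI, ρ(E∖I))` follows from (PLD)(M) and a pointwise,
complement-symmetrised certificate on the rank range `[0, R]` built on the four instances `(0,0,1,0)`, `(0,1,1,0)`, `(0,0,2,0)`,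
`(1,1,1,3)` with multipliers `D > 0`, `N₁ … N₄`. -/
theorem target_of_cert (M : Matroid α) [M.Finite]
    (hPLD : ∀ lo hi δ Θ : ℕ, Θ ≤ lo + hi + δ → (lo = 0 ∨ lo + hi + δ ≤ Θ) →
      (∑ I ∈ (gr M).powerset, (if lo ≤ (M.eRk (I : Set α)).toNat ∧ (M.eRk (I : Set α)).toNat ≤ hi ∧
          Θ ≤ (M.eRk ((gr M \ I : Finset α) : Set α)).toNat + (M.eRk (I : Set α)).toNat then
          ((M.eRk ((gr M \ I : Finset α) : Set α)).toNat).choose δ else 0)) ≤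
        ∑ I ∈ (gr M).powerset, (if lo + δ ≤ (M.eRk ((gr M \ I : Finset α) : Set α)).toNat ∧
          (M.eRk ((gr M \ I : Finset α) : Set α)).toNat ≤ hi + δ then
          ((M.eRk ((gr M \ I : Finset α) : Set α)).toNat).choose δ else 0))
    (R : ℕ) (hR : M.eRank ≤ R) (tL tR : ℕ → ℕ → ℕ) (D N₁ N₂ N₃ N₄ : ℕ) (hD : 0 < D)
    (hcert : ∀ x ∈ range (R + 1), ∀ f ∈ range (R + 1),
      D * (tL x f + tL f x) +
        N₁ * ((if 0 + 1 ≤ f ∧ f ≤ 0 + 1 then (f).choose 1 else 0) + (if 0 + 1 ≤ x ∧ x ≤ 0 + 1 then (x).choose 1 else 0)) +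
        N₂ * ((if 0 + 1 ≤ f ∧ f ≤ 1 + 1 then (f).choose 1 else 0) + (if 0 + 1 ≤ x ∧ x ≤ 1 + 1 then (x).choose 1 else 0)) +
        N₃ * ((if 0 + 2 ≤ f ∧ f ≤ 0 + 2 then (f).choose 2 else 0) + (if 0 + 2 ≤ x ∧ x ≤ 0 + 2 then (x).choose 2 else 0)) +
        N₄ * ((if 1 + 1 ≤ f ∧ f ≤ 1 + 1 then (f).choose 1 else 0) + (if 1 + 1 ≤ x ∧ x ≤ 1 + 1 then (x).choose 1 else 0)) ≤
      D * (tR x f + tR f x) +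
        N₁ * ((if 0 ≤ x ∧ x ≤ 0 ∧ 0 ≤ f + x then (f).choose 1 else 0) + (if 0 ≤ f ∧ f ≤ 0 ∧ 0 ≤ x + f then (x).choose 1 else 0)) +
        N₂ * ((if 0 ≤ x ∧ x ≤ 1 ∧ 0 ≤ f + x then (f).choose 1 else 0) + (if 0 ≤ f ∧ f ≤ 1 ∧ 0 ≤ x + f then (x).choose 1 else 0)) +
        N₃ * ((if 0 ≤ x ∧ x ≤ 0 ∧ 0 ≤ f + x then (f).choose 2 else 0) + (if 0 ≤ f ∧ f ≤ 0 ∧ 0 ≤ x + f then (x).choose 2 else 0)) +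
        N₄ * ((if 1 ≤ x ∧ x ≤ 1 ∧ 3 ≤ f + x then (f).choose 1 else 0) + (if 1 ≤ f ∧ f ≤ 1 ∧ 3 ≤ x + f then (x).choose 1 else 0))) :
    ∑ I ∈ (gr M).powerset, tL (M.eRk (I : Set α)).toNat (M.eRk ((gr M \ I : Finset α) : Set α)).toNat ≤
      ∑ I ∈ (gr M).powerset, tR (M.eRk (I : Set α)).toNat (M.eRk ((gr M \ I : Finset α) : Set α)).toNat := by
  have hsum := Finset.sum_le_sum (s := (gr M).powerset) fun I _ =>
    hcert (M.eRk (I : Set α)).toNat (mem_range.2 (Nat.lt_succ_of_le (toNat_eRk_le_of_eRank_le M hR _)))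
      (M.eRk ((gr M \ I : Finset α) : Set α)).toNat
      (mem_range.2 (Nat.lt_succ_of_le (toNat_eRk_le_of_eRank_le M hR _)))
  simp only [Finset.sum_add_distrib, ← Finset.mul_sum] at hsum
  have e0 := PLDClosure.sum_complement M tL
  have e0' := PLDClosure.sum_complement M tR
  have e1 := PLDClosure.sum_complement M (fun x f => (if 0 + 1 ≤ f ∧ f ≤ 0 + 1 then (f).choose 1 else 0))
  have e2 := PLDClosure.sum_complement M (fun x f => (if 0 + 1 ≤ f ∧ f ≤ 1 + 1 then (f).choose 1 else 0))
  have e3 := PLDClosure.sum_complement M (fun x f => (if 0 + 2 ≤ f ∧ f ≤ 0 + 2 then (f).choose 2 else 0))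
  have e4 := PLDClosure.sum_complement M (fun x f => (if 1 + 1 ≤ f ∧ f ≤ 1 + 1 then (f).choose 1 else 0))
  have e5 := PLDClosure.sum_complement M (fun x f => (if 0 ≤ x ∧ x ≤ 0 ∧ 0 ≤ f + x then (f).choose 1 else 0))
  have e6 := PLDClosure.sum_complement M (fun x f => (if 0 ≤ x ∧ x ≤ 1 ∧ 0 ≤ f + x then (f).choose 1 else 0))
  have e7 := PLDClosure.sum_complement M (fun x f => (if 0 ≤ x ∧ x ≤ 0 ∧ 0 ≤ f + x then (f).choose 2 else 0))
  have e8 := PLDClosure.sum_complement M (fun x f => (if 1 ≤ x ∧ x ≤ 1 ∧ 3 ≤ f + x then (f).choose 1 else 0))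
  beta_reduce at e1 e2 e3 e4 e5 e6 e7 e8
  rw [← e0, ← e0', ← e1, ← e2, ← e3, ← e4, ← e5, ← e6, ← e7, ← e8] at hsum
  have k1 := hPLD 0 0 1 0 (by norm_num) (Or.inl rfl)
  have k2 := hPLD 0 1 1 0 (by norm_num) (Or.inl rfl)
  have k3 := hPLD 0 0 2 0 (by norm_num) (Or.inl rfl)
  have k4 := hPLD 1 1 1 3 (by norm_num) (Or.inr (by norm_num))
  have m1 := Nat.mul_le_mul_left N₁ k1
  have m2 := Nat.mul_le_mul_left N₂ k2
  have m3 := Nat.mul_le_mul_left N₃ k3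
  have m4 := Nat.mul_le_mul_left N₄ k4
  have key : D * ∑ I ∈ (gr M).powerset, tL (M.eRk (I : Set α)).toNat (M.eRk ((gr M \ I : Finset α) : Set α)).toNat ≤
      D * ∑ I ∈ (gr M).powerset, tR (M.eRk (I : Set α)).toNat (M.eRk ((gr M \ I : Finset α) : Set α)).toNat := by
    nlinarith [hsum, m1, m2, m3, m4]
  exact Nat.le_of_mul_le_mul_left key hD

/-- THE TABLE: for every canonical instance `lo ≤ hi ≤ 5`, `δ ≤ 5` of (PLD) on `M ⊕ U_{2,3}` (target summands
`Σ_i C(3,i)·[…]` over the four states of the triangle), the multipliers `(D, N₁, N₂, N₃, N₄)` of the table give a pointwise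
certificate on `[0,3]²` (trivial instances: `(1,0,0,0,0)`). A finite computation. -/
theorem triangle_cert_table :
    ∀ lo ∈ range 6, ∀ hi ∈ range 6, ∀ δ ∈ range 6, lo ≤ hi →
      0 < ((fun lo hi δ : ℕ => if (lo, hi, δ) = (0, 0, 1) then (3, 2, 0, 0, 0) else if (lo, hi, δ) = (0, 0, 2) then (2, 3, 1, 0, 0) else if (lo, hi, δ) = (0, 0, 3) then (2, 3, 3, 0, 0) else if (lo, hi, δ) = (0, 0, 4) then (3, 0, 2, 0, 0) else if (lo, hi, δ) = (0, 1, 1) then (2, 3, 1, 2, 0) else if (lo, hi, δ) = (0, 1, 2) then (1, 5, 4, 2, 0) else if (lo, hi, δ) = (0, 1, 3) then (1, 0, 9, 0, 0) else if (lo, hi, δ) = (0, 2, 1) then (2, 7, 7, 0, 0) else if (lo, hi, δ) = (0, 2, 2) then (1, 0, 12, 0, 0) else if (lo, hi, δ) = (0, 3, 1) then (3, 0, 11, 0, 0) else if (lo, hi, δ) = (1, 1, 1) then (3, 3, 2, 2, 0) else if (lo, hi, δ) = (1, 1, 2) then (2, 9, 9, 0, 0) else if (lo, hi, δ) = (1,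 1, 3) then (1, 0, 6, 0, 0) else if (lo, hi, δ) = (1, 2, 1) then (3, 9, 10, 0, 0) else if (lo, hi, δ) = (1, 2, 2) then (1, 0, 10, 0, 0) else if (lo, hi, δ) = (1, 3, 1) then (1, 0, 3, 0, 0) else if (lo, hi, δ) = (2, 2, 1) then (1, 0, 1, 3, 0) else if (lo, hi, δ) = (2, 2, 2) then (1, 0, 0, 0, 4) else if (lo, hi, δ) = (2, 3, 1) then (1, 0, 0, 0, 2) else ((1 : ℕ), (0 : ℕ), (0 : ℕ), (0 : ℕ), (0 : ℕ))) lo hi δ).1 ∧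
      ∀ x ∈ range 4, ∀ f ∈ range 4,
        ((fun lo hi δ : ℕ => if (lo, hi, δ) = (0, 0, 1) then (3, 2, 0, 0, 0) else if (lo, hi, δ) = (0, 0, 2) then (2, 3, 1, 0, 0) else if (lo, hi, δ) = (0, 0, 3) then (2, 3, 3, 0, 0) else if (lo, hi, δ) = (0, 0, 4) then (3, 0, 2, 0, 0) else if (lo, hi, δ) = (0, 1, 1) then (2, 3, 1, 2, 0) else if (lo, hi, δ) = (0, 1, 2) then (1, 5, 4, 2, 0) else if (lo, hi, δ) = (0, 1, 3) then (1, 0, 9, 0, 0) else if (lo, hi, δ) = (0, 2, 1) then (2, 7, 7, 0, 0) else if (lo, hi, δ) = (0, 2, 2) then (1, 0, 12, 0, 0) else if (lo, hi, δ) = (0, 3, 1) then (3, 0, 11, 0, 0) else if (lo, hi, δ) = (1, 1, 1) then (3, 3, 2, 2, 0) else if (lo, hi, δ) = (1, 1, 2) then (2, 9, 9, 0, 0) else if (lo, hi, δ) = (1, 1, 3) then (1, 0, 6, 0, 0) else if (lo, hi, δ) = (1, 2, 1) then (3, 9, 10, 0, 0) else if (lo, hi, δ) = (1, 2, 2) then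 (1, 0, 10, 0, 0) else if (lo, hi, δ) = (1, 3, 1) then (1, 0, 3, 0, 0) else if (lo, hi, δ) = (2, 2, 1) then (1, 0, 1, 3, 0) else if (lo, hi, δ) = (2, 2, 2) then (1, 0, 0, 0, 4) else if (lo, hi, δ) = (2, 3, 1) then (1, 0, 0, 0, 2) else ((1 : ℕ), (0 : ℕ), (0 : ℕ), (0 : ℕ), (0 : ℕ))) lo hi δ).1 * ((∑ i ∈ range 4, Nat.choose 3 i * (if lo ≤ x + min i 2 ∧ x + min i 2 ≤ hi ∧ (if lo = 0 then 0 else lo + hi + δ) ≤ (f + min (3 - i) 2) + (x + min i 2) then (f + min (3 - i) 2).choose δ else 0)) + (∑ i ∈ range 4, Nat.choose 3 i * (if lo ≤ f + min i 2 ∧ f + min i 2 ≤ hi ∧ (if lo = 0 then 0 else lo + hi + δ) ≤ (x + min (3 - i) 2) + (f + min i 2) then (x + min (3 - i) 2).choose δ else 0))) +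
          ((fun lo hi δ : ℕ => if (lo, hi, δ) = (0, 0, 1) then (3, 2, 0, 0, 0) else if (lo, hi, δ) = (0, 0, 2) then (2, 3, 1, 0, 0) else if (lo, hi, δ) = (0, 0, 3) then (2, 3, 3, 0, 0) else if (lo, hi, δ) = (0, 0, 4) then (3, 0, 2, 0, 0) else if (lo, hi, δ) = (0, 1, 1) then (2, 3, 1, 2, 0) else if (lo, hi, δ) = (0, 1, 2) then (1, 5, 4, 2, 0) else if (lo, hi, δ) = (0, 1, 3) then (1, 0, 9, 0, 0) else if (lo, hi, δ) = (0, 2, 1) then (2, 7, 7, 0, 0) else if (lo, hi, δ) = (0, 2, 2) then (1, 0, 12, 0, 0) else if (lo, hi, δ) = (0, 3, 1) then (3, 0, 11, 0, 0) else if (lo, hi, δ) = (1, 1, 1) then (3, 3, 2, 2, 0) else if (lo, hi, δ) = (1, 1, 2) then (2, 9, 9, 0, 0) else if (lo, hi, δ) = (1, 1, 3) then (1, 0, 6, 0, 0) else if (lo, hi, δ) = (1, 2, 1) then (3, 9, 10, 0, 0) else if (lo, hi, δ) = (1, 2, 2) then (1, 0, 10, 0, 0) else if (lo, hi, δ) =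 (1, 3, 1) then (1, 0, 3, 0, 0) else if (lo, hi, δ) = (2, 2, 1) then (1, 0, 1, 3, 0) else if (lo, hi, δ) = (2, 2, 2) then (1, 0, 0, 0, 4) else if (lo, hi, δ) = (2, 3, 1) then (1, 0, 0, 0, 2) else ((1 : ℕ), (0 : ℕ), (0 : ℕ), (0 : ℕ), (0 : ℕ))) lo hi δ).2.1 * ((if 0 + 1 ≤ f ∧ f ≤ 0 + 1 then (f).choose 1 else 0) + (if 0 + 1 ≤ x ∧ x ≤ 0 + 1 then (x).choose 1 else 0)) +
          ((fun lo hi δ : ℕ => if (lo, hi, δ) = (0, 0, 1) then (3, 2, 0, 0, 0) else if (lo, hi, δ) = (0, 0, 2) then (2, 3, 1, 0, 0) else if (lo, hi, δ) = (0, 0, 3) then (2, 3, 3, 0, 0) else if (lo, hi, δ) = (0, 0, 4) then (3, 0, 2, 0, 0) else if (lo, hi, δ) = (0, 1, 1) then (2, 3, 1, 2, 0) else if (lo, hi, δ) = (0, 1, 2) then (1, 5, 4, 2, 0) else if (lo, hi, δ) = (0, 1, 3) then (1, 0, 9, 0, 0) else if (lo, hi, δ) = (0, 2, 1) then (2, 7,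 7, 0, 0) else if (lo, hi, δ) = (0, 2, 2) then (1, 0, 12, 0, 0) else if (lo, hi, δ) = (0, 3, 1) then (3, 0, 11, 0, 0) else if (lo, hi, δ) = (1, 1, 1) then (3, 3, 2, 2, 0) else if (lo, hi, δ) = (1, 1, 2) then (2, 9, 9, 0, 0) else if (lo, hi, δ) = (1, 1, 3) then (1, 0, 6, 0, 0) else if (lo, hi, δ) = (1, 2, 1) then (3, 9, 10, 0, 0) else if (lo, hi, δ) = (1, 2, 2) then (1, 0, 10, 0, 0) else if (lo, hi, δ) = (1, 3, 1) then (1, 0, 3, 0, 0) else if (lo, hi, δ) = (2, 2, 1) then (1, 0, 1, 3, 0) else if (lo, hi, δ) = (2, 2, 2) then (1, 0, 0, 0, 4) else if (lo, hi, δ) = (2, 3, 1) then (1, 0, 0, 0, 2) else ((1 : ℕ), (0 : ℕ), (0 : ℕ), (0 : ℕ), (0 : ℕ))) lo hi δ).2.2.1 * ((if 0 + 1 ≤ f ∧ f ≤ 1 + 1 then (f).choose 1 else 0) + (if 0 + 1 ≤ x ∧ x ≤ 1 + 1 then (x).choose 1 else 0)) +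
          ((fun lo hi δ : ℕ => if (lo, hi, δ) = (0, 0, 1) then (3, 2, 0, 0, 0) else if (lo, hi, δ) = (0, 0, 2) then (2, 3, 1, 0, 0) else if (lo, hi, δ) = (0, 0, 3) then (2, 3, 3, 0, 0) else if (lo, hi, δ) = (0, 0, 4) then (3, 0, 2, 0, 0) else if (lo, hi, δ) = (0, 1, 1) then (2, 3, 1, 2, 0) else if (lo, hi, δ) = (0, 1, 2) then (1, 5, 4, 2, 0) else if (lo, hi, δ) = (0, 1, 3) then (1, 0, 9, 0, 0) else if (lo, hi, δ) = (0, 2, 1) then (2, 7, 7, 0, 0) else if (lo, hi, δ) = (0, 2, 2) then (1, 0, 12, 0, 0) else if (lo, hi, δ) = (0, 3, 1) then (3, 0, 11, 0, 0) else if (lo, hi, δ) = (1, 1, 1) then (3, 3, 2, 2, 0) else if (lo, hi, δ) = (1, 1, 2) then (2, 9, 9, 0, 0) else if (lo, hi, δ) = (1, 1, 3) then (1, 0, 6, 0, 0) else if (lo, hi, δ) = (1, 2, 1) then (3, 9, 10, 0, 0) else if (lo, hi, δ) = (1, 2, 2) then (1, 0, 10, 0, 0) else if (lo, hi, δ) =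 (1, 3, 1) then (1, 0, 3, 0, 0) else if (lo, hi, δ) = (2, 2, 1) then (1, 0, 1, 3, 0) else if (lo, hi, δ) = (2, 2, 2) then (1, 0, 0, 0, 4) else if (lo, hi, δ) = (2, 3, 1) then (1, 0, 0, 0, 2) else ((1 : ℕ), (0 : ℕ), (0 : ℕ), (0 : ℕ), (0 : ℕ))) lo hi δ).2.2.2.1 * ((if 0 + 2 ≤ f ∧ f ≤ 0 + 2 then (f).choose 2 else 0) + (if 0 + 2 ≤ x ∧ x ≤ 0 + 2 then (x).choose 2 else 0)) +
          ((fun lo hi δ : ℕ => if (lo, hi, δ) = (0, 0, 1) then (3, 2, 0, 0, 0) else if (lo, hi, δ) = (0, 0, 2) then (2, 3, 1, 0, 0) else if (lo, hi, δ) = (0, 0, 3) then (2, 3, 3, 0, 0) else if (lo, hi, δ) = (0, 0, 4) then (3, 0, 2, 0, 0) else if (lo, hi, δ) = (0, 1, 1) then (2, 3, 1, 2, 0) else if (lo, hi, δ) = (0, 1, 2) then (1, 5, 4, 2, 0) else if (lo, hi, δ) = (0, 1, 3) then (1, 0, 9, 0, 0) else if (lo, hi, δ) = (0, 2, 1) then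 (2, 7, 7, 0, 0) else if (lo, hi, δ) = (0, 2, 2) then (1, 0, 12, 0, 0) else if (lo, hi, δ) = (0, 3, 1) then (3, 0, 11, 0, 0) else if (lo, hi, δ) = (1, 1, 1) then (3, 3, 2, 2, 0) else if (lo, hi, δ) = (1, 1, 2) then (2, 9, 9, 0, 0) else if (lo, hi, δ) = (1, 1, 3) then (1, 0, 6, 0, 0) else if (lo, hi, δ) = (1, 2, 1) then (3, 9, 10, 0, 0) else if (lo, hi, δ) = (1, 2, 2) then (1, 0, 10, 0, 0) else if (lo, hi, δ) = (1, 3, 1) then (1, 0, 3, 0, 0) else if (lo, hi, δ) = (2, 2, 1) then (1, 0, 1, 3, 0) else if (lo, hi, δ) = (2, 2, 2) then (1, 0, 0, 0, 4) else if (lo, hi, δ) = (2, 3, 1) then (1, 0, 0, 0, 2) else ((1 : ℕ), (0 : ℕ), (0 : ℕ), (0 : ℕ), (0 : ℕ))) lo hi δ).2.2.2.2 * ((if 1 + 1 ≤ f ∧ f ≤ 1 + 1 then (f).choose 1 else 0) + (if 1 + 1 ≤ x ∧ x ≤ 1 + 1 then (x).choose 1 else 0)) ≤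
        ((fun lo hi δ : ℕ => if (lo, hi, δ) = (0, 0, 1) then (3, 2, 0, 0, 0) else if (lo, hi, δ) = (0, 0, 2) then (2, 3, 1, 0, 0) else if (lo, hi, δ) = (0, 0, 3) then (2, 3, 3, 0, 0) else if (lo, hi, δ) = (0, 0, 4) then (3, 0, 2, 0, 0) else if (lo, hi, δ) = (0, 1, 1) then (2, 3, 1, 2, 0) else if (lo, hi, δ) = (0, 1, 2) then (1, 5, 4, 2, 0) else if (lo, hi, δ) = (0, 1, 3) then (1, 0, 9, 0, 0) else if (lo, hi, δ) = (0, 2, 1) then (2, 7, 7, 0, 0) else if (lo, hi, δ) = (0, 2, 2) then (1, 0, 12, 0, 0) else if (lo, hi, δ) = (0, 3, 1) then (3, 0, 11, 0, 0) else if (lo, hi, δ) = (1, 1, 1) then (3, 3, 2, 2, 0) else if (lo, hi, δ) = (1, 1, 2) then (2, 9, 9, 0, 0) else if (lo, hi, δ) = (1, 1, 3) then (1, 0, 6, 0, 0) else if (lo, hi, δ) = (1, 2, 1) then (3, 9, 10, 0, 0) else if (lo, hi, δ) = (1, 2, 2) then (1, 0, 10, 0, 0) else if (lo, hi, δ) =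 (1, 3, 1) then (1, 0, 3, 0, 0) else if (lo, hi, δ) = (2, 2, 1) then (1, 0, 1, 3, 0) else if (lo, hi, δ) = (2, 2, 2) then (1, 0, 0, 0, 4) else if (lo, hi, δ) = (2, 3, 1) then (1, 0, 0, 0, 2) else ((1 : ℕ), (0 : ℕ), (0 : ℕ), (0 : ℕ), (0 : ℕ))) lo hi δ).1 * ((∑ i ∈ range 4, Nat.choose 3 i * (if lo + δ ≤ f + min (3 - i) 2 ∧ f + min (3 - i) 2 ≤ hi + δ then (f + min (3 - i) 2).choose δ else 0)) + (∑ i ∈ range 4, Nat.choose 3 i * (if lo + δ ≤ x + min (3 - i) 2 ∧ x + min (3 - i) 2 ≤ hi + δ then (x + min (3 - i) 2).choose δ else 0))) +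
          ((fun lo hi δ : ℕ => if (lo, hi, δ) = (0, 0, 1) then (3, 2, 0, 0, 0) else if (lo, hi, δ) = (0, 0, 2) then (2, 3, 1, 0, 0) else if (lo, hi, δ) = (0, 0, 3) then (2, 3, 3, 0, 0) else if (lo, hi, δ) = (0, 0, 4) then (3, 0, 2, 0, 0) else if (lo, hi, δ) = (0, 1, 1) then (2, 3, 1, 2, 0) else if (lo, hi, δ) = (0, 1, 2) then (1, 5, 4, 2, 0) else if (lo, hi, δ) = (0, 1, 3) then (1, 0, 9, 0, 0) else if (lo, hi, δ) = (0, 2, 1) then (2, 7, 7, 0, 0) else if (lo, hi, δ) = (0, 2, 2) then (1, 0, 12, 0, 0) else if (lo, hi, δ) = (0, 3, 1) then (3, 0, 11, 0, 0) else if (lo, hi, δ) = (1, 1, 1) then (3, 3, 2, 2, 0) else if (lo, hi, δ) = (1, 1, 2) then (2, 9, 9, 0, 0) else if (lo, hi, δ) = (1, 1, 3) then (1, 0, 6, 0, 0) else if (lo, hi, δ) = (1, 2, 1) then (3, 9, 10, 0, 0) else if (lo, hi, δ) = (1, 2, 2) then (1, 0, 10, 0, 0) else if (lo, hi, δ) =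 (1, 3, 1) then (1, 0, 3, 0, 0) else if (lo, hi, δ) = (2, 2, 1) then (1, 0, 1, 3, 0) else if (lo, hi, δ) = (2, 2, 2) then (1, 0, 0, 0, 4) else if (lo, hi, δ) = (2, 3, 1) then (1, 0, 0, 0, 2) else ((1 : ℕ), (0 : ℕ), (0 : ℕ), (0 : ℕ), (0 : ℕ))) lo hi δ).2.1 * ((if 0 ≤ x ∧ x ≤ 0 ∧ 0 ≤ f + x then (f).choose 1 else 0) + (if 0 ≤ f ∧ f ≤ 0 ∧ 0 ≤ x + f then (x).choose 1 else 0)) +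
          ((fun lo hi δ : ℕ => if (lo, hi, δ) = (0, 0, 1) then (3, 2, 0, 0, 0) else if (lo, hi, δ) = (0, 0, 2) then (2, 3, 1, 0, 0) else if (lo, hi, δ) = (0, 0, 3) then (2, 3, 3, 0, 0) else if (lo, hi, δ) = (0, 0, 4) then (3, 0, 2, 0, 0) else if (lo, hi, δ) = (0, 1, 1) then (2, 3, 1, 2, 0) else if (lo, hi, δ) = (0, 1, 2) then (1, 5, 4, 2, 0) else if (lo, hi, δ) = (0, 1, 3) then (1, 0, 9, 0, 0) else if (lo, hi, δ) = (0, 2, 1) then (2, 7, 7, 0, 0) else if (lo, hi, δ) = (0, 2, 2) then (1, 0, 12, 0, 0) else if (lo, hi, δ) = (0, 3, 1) then (3, 0, 11, 0, 0) else if (lo, hi, δ) = (1, 1, 1) then (3, 3, 2, 2, 0) else if (lo, hi, δ) = (1, 1, 2) then (2, 9, 9, 0, 0) else if (lo, hi, δ) = (1, 1, 3) then (1, 0, 6, 0, 0) else if (lo, hi, δ) = (1, 2, 1) then (3, 9, 10, 0, 0) else if (lo, hi, δ) = (1, 2, 2) then (1, 0, 10, 0, 0) else if (lo, hi, δ) =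 (1, 3, 1) then (1, 0, 3, 0, 0) else if (lo, hi, δ) = (2, 2, 1) then (1, 0, 1, 3, 0) else if (lo, hi, δ) = (2, 2, 2) then (1, 0, 0, 0, 4) else if (lo, hi, δ) = (2, 3, 1) then (1, 0, 0, 0, 2) else ((1 : ℕ), (0 : ℕ), (0 : ℕ), (0 : ℕ), (0 : ℕ))) lo hi δ).2.2.1 * ((if 0 ≤ x ∧ x ≤ 1 ∧ 0 ≤ f + x then (f).choose 1 else 0) + (if 0 ≤ f ∧ f ≤ 1 ∧ 0 ≤ x + f then (x).choose 1 else 0)) +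
          ((fun lo hi δ : ℕ => if (lo, hi, δ) = (0, 0, 1) then (3, 2, 0, 0, 0) else if (lo, hi, δ) = (0, 0, 2) then (2, 3, 1, 0, 0) else if (lo, hi, δ) = (0, 0, 3) then (2, 3, 3, 0, 0) else if (lo, hi, δ) = (0, 0, 4) then (3, 0, 2, 0, 0) else if (lo, hi, δ) = (0, 1, 1) then (2, 3, 1, 2, 0) else if (lo, hi, δ) = (0, 1, 2) then (1, 5, 4, 2, 0) else if (lo, hi, δ) = (0, 1, 3) then (1, 0, 9, 0, 0) else if (lo, hi, δ) = (0, 2, 1) then (2, 7, 7, 0, 0) else if (lo, hi, δ) = (0, 2, 2) then (1, 0, 12, 0, 0) else if (lo, hi, δ) = (0, 3, 1) then (3, 0, 11, 0, 0) else if (lo, hi, δ) = (1, 1, 1) then (3, 3, 2, 2, 0) else if (lo, hi, δ) = (1, 1, 2) then (2, 9, 9, 0, 0) else if (lo, hi, δ) = (1, 1, 3) then (1, 0, 6, 0, 0) else if (lo, hi, δ) = (1, 2, 1) then (3, 9, 10, 0, 0) else if (lo, hi, δ) = (1, 2, 2) then (1, 0, 10, 0, 0) else if (lo, hi, δ) =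 (1, 3, 1) then (1, 0, 3, 0, 0) else if (lo, hi, δ) = (2, 2, 1) then (1, 0, 1, 3, 0) else if (lo, hi, δ) = (2, 2, 2) then (1, 0, 0, 0, 4) else if (lo, hi, δ) = (2, 3, 1) then (1, 0, 0, 0, 2) else ((1 : ℕ), (0 : ℕ), (0 : ℕ), (0 : ℕ), (0 : ℕ))) lo hi δ).2.2.2.1 * ((if 0 ≤ x ∧ x ≤ 0 ∧ 0 ≤ f + x then (f).choose 2 else 0) + (if 0 ≤ f ∧ f ≤ 0 ∧ 0 ≤ x + f then (x).choose 2 else 0)) +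
          ((fun lo hi δ : ℕ => if (lo, hi, δ) = (0, 0, 1) then (3, 2, 0, 0, 0) else if (lo, hi, δ) = (0, 0, 2) then (2, 3, 1, 0, 0) else if (lo, hi, δ) = (0, 0, 3) then (2, 3, 3, 0, 0) else if (lo, hi, δ) = (0, 0, 4) then (3, 0, 2, 0, 0) else if (lo, hi, δ) = (0, 1, 1) then (2, 3, 1, 2, 0) else if (lo, hi, δ) = (0, 1, 2) then (1, 5, 4, 2, 0) else if (lo, hi, δ) = (0, 1, 3) then (1, 0, 9, 0, 0) else if (lo, hi, δ) = (0, 2, 1) then (2, 7, 7, 0, 0) else if (lo, hi, δ) = (0, 2, 2) then (1, 0, 12, 0, 0) else if (lo, hi, δ) = (0, 3, 1) then (3, 0, 11, 0, 0) else if (lo, hi, δ) = (1, 1, 1) then (3, 3, 2, 2, 0) else if (lo, hi, δ) = (1, 1, 2) then (2, 9, 9, 0, 0) else if (lo, hi, δ) = (1, 1, 3) then (1, 0, 6, 0, 0) else if (lo, hi, δ) = (1, 2, 1) then (3, 9, 10, 0, 0) else if (lo, hi, δ) = (1, 2, 2) then (1, 0, 10, 0, 0) else if (lo, hi, δ) =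 (1, 3, 1) then (1, 0, 3, 0, 0) else if (lo, hi, δ) = (2, 2, 1) then (1, 0, 1, 3, 0) else if (lo, hi, δ) = (2, 2, 2) then (1, 0, 0, 0, 4) else if (lo, hi, δ) = (2, 3, 1) then (1, 0, 0, 0, 2) else ((1 : ℕ), (0 : ℕ), (0 : ℕ), (0 : ℕ), (0 : ℕ))) lo hi δ).2.2.2.2 * ((if 1 ≤ x ∧ x ≤ 1 ∧ 3 ≤ f + x then (f).choose 1 else 0) + (if 1 ≤ f ∧ f ≤ 1 ∧ 3 ≤ x + f then (x).choose 1 else 0)) := by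
  decide

/-- PER-LAYER DOMINANCE FOR «M ⊕ U_{2,3}» FOR EVERY FINITE MATROID `M` OF RANK `≤ 3` SATISFYING (PLD) (every such `M` does:
`PLDParExt.pld_of_eRank_le_three`; the triangle is `truncate (freeOn F) 2` with `|F| = 3`). -/
theorem pld_disjointSum_triangle (M : Matroid α) [M.Finite] (h3 : M.eRank ≤ 3)
    (hPLD : ∀ lo hi δ Θ : ℕ, Θ ≤ lo + hi + δ → (lo = 0 ∨ lo + hi + δ ≤ Θ) →
      (∑ I ∈ (gr M).powerset, (if lo ≤ (M.eRk (I : Set α)).toNat ∧ (M.eRk (I : Set α)).toNat ≤ hi ∧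
          Θ ≤ (M.eRk ((gr M \ I : Finset α) : Set α)).toNat + (M.eRk (I : Set α)).toNat then
          ((M.eRk ((gr M \ I : Finset α) : Set α)).toNat).choose δ else 0)) ≤
        ∑ I ∈ (gr M).powerset, (if lo + δ ≤ (M.eRk ((gr M \ I : Finset α) : Set α)).toNat ∧
          (M.eRk ((gr M \ I : Finset α) : Set α)).toNat ≤ hi + δ then
          ((M.eRk ((gr M \ I : Finset α) : Set α)).toNat).choose δ else 0))
    (F : Finset α) (hF : F.card = 3)
    (h : Disjoint M.E (@Matroid.truncate α (Matroid.freeOn (F : Set α)) (PLDTruncate.freeOn_finite' F) 2).E) :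
    haveI := PLDTruncate.freeOn_finite' F
    haveI := PLDClosure.disjointSum_finite' _ _ h
    ∀ lo hi δ Θ : ℕ, Θ ≤ lo + hi + δ → (lo = 0 ∨ lo + hi + δ ≤ Θ) →
      (∑ I ∈ (gr (M.disjointSum (Matroid.truncate (Matroid.freeOn (F : Set α)) 2) h)).powerset, (if lo ≤ ((M.disjointSum (Matroid.truncate (Matroid.freeOn (F : Set α)) 2) h).eRk (I : Set α)).toNat ∧ ((M.disjointSum (Matroid.truncate (Matroid.freeOn (F : Set α)) 2) h).eRk (I : Set α)).toNat ≤ hi ∧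
          Θ ≤ ((M.disjointSum (Matroid.truncate (Matroid.freeOn (F : Set α)) 2) h).eRk ((gr (M.disjointSum (Matroid.truncate (Matroid.freeOn (F : Set α)) 2) h) \ I : Finset α) : Set α)).toNat + ((M.disjointSum (Matroid.truncate (Matroid.freeOn (F : Set α)) 2) h).eRk (I : Set α)).toNat then
          (((M.disjointSum (Matroid.truncate (Matroid.freeOn (F : Set α)) 2) h).eRk ((gr (M.disjointSum (Matroid.truncate (Matroid.freeOn (F : Set α)) 2) h) \ I : Finset α) : Set α)).toNat).choose δ else 0)) ≤
        ∑ I ∈ (gr (M.disjointSum (Matroid.truncate (Matroid.freeOn (F : Set α)) 2) h)).powerset, (if lo + δ ≤ ((M.disjointSum (Matroid.truncate (Matroid.freeOn (F : Set α)) 2) h).eRk ((gr (M.disjointSum (Matroid.truncate (Matroid.freeOn (F : Set α)) 2) h) \ I : Finset α) : Set α)).toNat ∧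
          ((M.disjointSum (Matroid.truncate (Matroid.freeOn (F : Set α)) 2) h).eRk ((gr (M.disjointSum (Matroid.truncate (Matroid.freeOn (F : Set α)) 2) h) \ I : Finset α) : Set α)).toNat ≤ hi + δ then
          (((M.disjointSum (Matroid.truncate (Matroid.freeOn (F : Set α)) 2) h).eRk ((gr (M.disjointSum (Matroid.truncate (Matroid.freeOn (F : Set α)) 2) h) \ I : Finset α) : Set α)).toNat).choose δ else 0) := by
  haveI := PLDTruncate.freeOn_finite' F
  haveI := PLDClosure.disjointSum_finite' _ _ h
  have hU : (Matroid.truncate (Matroid.freeOn (F : Set α)) 2).eRank ≤ ((2 : ℕ) : ℕ∞) := by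
    rw [Matroid.truncate_eRank]; exact min_le_right _ _
  have h3' : M.eRank ≤ ((3 : ℕ) : ℕ∞) := by exact_mod_cast h3
  have hb : ∀ I ∈ (gr (M.disjointSum (Matroid.truncate (Matroid.freeOn (F : Set α)) 2) h)).powerset,
      ((M.disjointSum (Matroid.truncate (Matroid.freeOn (F : Set α)) 2) h).eRk (I : Set α)).toNat ≤ 5 ∧ ((M.disjointSum (Matroid.truncate (Matroid.freeOn (F : Set α)) 2) h).eRk ((gr (M.disjointSum (Matroid.truncate (Matroid.freeOn (F : Set α)) 2) h) \ I : Finset α) : Set α)).toNat ≤ 5 := by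
    intro I _
    constructor
    · rw [PLDClosure.toNat_eRk_disjointSum]
      have h1 := toNat_eRk_le_of_eRank_le M h3' ((I ∩ gr M : Finset α) : Set α)
      have h2 := toNat_eRk_le_of_eRank_le _ hU ((I ∩ gr (Matroid.truncate (Matroid.freeOn (F : Set α)) 2) : Finset α) : Set α)
      omega
    · rw [PLDClosure.toNat_eRk_disjointSum]
      have h1 := toNat_eRk_le_of_eRank_le M h3' (((gr (M.disjointSum (Matroid.truncate (Matroid.freeOn (F : Set α)) 2) h) \ I) ∩ gr M : Finset α) : Set α)
      have h2 := toNat_eRk_le_of_eRank_le _ hU (((gr (M.disjointSum (Matroid.truncate (Matroid.freeOn (F : Set α)) 2) h) \ I) ∩ gr (Matroid.truncate (Matroid.freeOn (F : Set α)) 2) : Finset α) : Set α)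
      omega
  refine PLDSymCex.pld_of_bounded (gr (M.disjointSum (Matroid.truncate (Matroid.freeOn (F : Set α)) 2) h)).powerset (fun I : Finset α => ((M.disjointSum (Matroid.truncate (Matroid.freeOn (F : Set α)) 2) h).eRk (I : Set α)).toNat)
    (fun I : Finset α => ((M.disjointSum (Matroid.truncate (Matroid.freeOn (F : Set α)) 2) h).eRk ((gr (M.disjointSum (Matroid.truncate (Matroid.freeOn (F : Set α)) 2) h) \ I : Finset α) : Set α)).toNat) 5 hb ?_
  intro lo hi δ hlh hhR hδR
  have hL := PLDClosure.sum_powerset_disjointSum M _ h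
    (fun x f => if lo ≤ x ∧ x ≤ hi ∧ (if lo = 0 then 0 else lo + hi + δ) ≤ f + x then f.choose δ else 0)
  have hR := PLDClosure.sum_powerset_disjointSum M _ h
    (fun x f => if lo + δ ≤ f ∧ f ≤ hi + δ then f.choose δ else 0)
  beta_reduce at hL hR
  rw [hL, hR]
  have h2L : ∀ x₁ f₁ : ℕ,
      ∑ I₂ ∈ (gr (Matroid.truncate (Matroid.freeOn (F : Set α)) 2)).powerset,
        (if lo ≤ x₁ + ((Matroid.truncate (Matroid.freeOn (F : Set α)) 2).eRk (I₂ : Set α)).toNat ∧ x₁ + ((Matroid.truncate (Matroid.freeOn (F : Set α)) 2).eRk (I₂ : Set α)).toNat ≤ hi ∧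
            (if lo = 0 then 0 else lo + hi + δ) ≤ f₁ + ((Matroid.truncate (Matroid.freeOn (F : Set α)) 2).eRk ((gr (Matroid.truncate (Matroid.freeOn (F : Set α)) 2) \ I₂ : Finset α) : Set α)).toNat +
              (x₁ + ((Matroid.truncate (Matroid.freeOn (F : Set α)) 2).eRk (I₂ : Set α)).toNat) then
          (f₁ + ((Matroid.truncate (Matroid.freeOn (F : Set α)) 2).eRk ((gr (Matroid.truncate (Matroid.freeOn (F : Set α)) 2) \ I₂ : Finset α) : Set α)).toNat).choose δ else 0) =
      (∑ i ∈ range 4, Nat.choose 3 i * (if lo ≤ x₁ + min i 2 ∧ x₁ + min i 2 ≤ hi ∧ (if lo = 0 then 0 else lo + hi + δ) ≤ (f₁ + min (3 - i) 2) + (x₁ + min i 2) then (f₁ + min (3 - i) 2).choose δ else 0)) := by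
    intro x₁ f₁
    have := PLDTruncate.sum_powerset_truncate_freeOn F 2
      (fun x₂ f₂ => if lo ≤ x₁ + x₂ ∧ x₁ + x₂ ≤ hi ∧ (if lo = 0 then 0 else lo + hi + δ) ≤ f₁ + f₂ + (x₁ + x₂) then
        (f₁ + f₂).choose δ else 0)
    beta_reduce at this
    rw [hF] at this
    exact this
  have h2R : ∀ f₁ : ℕ,
      ∑ I₂ ∈ (gr (Matroid.truncate (Matroid.freeOn (F : Set α)) 2)).powerset,
        (if lo + δ ≤ f₁ + ((Matroid.truncate (Matroid.freeOn (F : Set α)) 2).eRk ((gr (Matroid.truncate (Matroid.freeOn (F : Set α)) 2) \ I₂ : Finset α) : Set α)).toNat ∧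
            f₁ + ((Matroid.truncate (Matroid.freeOn (F : Set α)) 2).eRk ((gr (Matroid.truncate (Matroid.freeOn (F : Set α)) 2) \ I₂ : Finset α) : Set α)).toNat ≤ hi + δ then
          (f₁ + ((Matroid.truncate (Matroid.freeOn (F : Set α)) 2).eRk ((gr (Matroid.truncate (Matroid.freeOn (F : Set α)) 2) \ I₂ : Finset α) : Set α)).toNat).choose δ else 0) =
      (∑ i ∈ range 4, Nat.choose 3 i * (if lo + δ ≤ f₁ + min (3 - i) 2 ∧ f₁ + min (3 - i) 2 ≤ hi + δ then (f₁ + min (3 - i) 2).choose δ else 0)) := by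
    intro f₁
    have := PLDTruncate.sum_powerset_truncate_freeOn F 2
      (fun x₂ f₂ => if lo + δ ≤ f₁ + f₂ ∧ f₁ + f₂ ≤ hi + δ then (f₁ + f₂).choose δ else 0)
    beta_reduce at this
    rw [hF] at this
    exact this
  simp only [h2L, h2R]
  obtain ⟨hDpos, hcert⟩ := triangle_cert_table lo (mem_range.2 (by omega)) hi (mem_range.2 (by omega))
    δ (mem_range.2 (by omega)) hlh
  exact target_of_cert M hPLD 3 h3' (fun x f => (∑ i ∈ range 4, Nat.choose 3 i * (if lo ≤ x + min i 2 ∧ x + min i 2 ≤ hi ∧ (if lo = 0 then 0 else lo + hi + δ) ≤ (f + min (3 - i) 2) + (x + min i 2) then (f + min (3 - i) 2).choose δ else 0))) (fun x f => (∑ i ∈ range 4, Nat.choose 3 i * (if lo + δ ≤ f + min (3 - i) 2 ∧ f + min (3 - i) 2 ≤ hi + δ then (f + min (3 - i) 2).choose δ else 0))) _ _ _ _ _ hDpos hcert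

/-- C-025 AT EVERY `(p, q)` ON EVERY TRUNCATION OF «(N₃ ⊕ U_{2,3}) ⊕ FREE POINTS» for every finite matroid `N₃` of rank `≤ 3`. -/
theorem rls_truncate_disjointSum_triangle_freeOn_of_eRank_le_three (M : Matroid α) [M.Finite] (h3 : M.eRank ≤ 3)
    (F : Finset α) (hF : F.card = 3)
    (h : Disjoint M.E (@Matroid.truncate α (Matroid.freeOn (F : Set α)) (PLDTruncate.freeOn_finite' F) 2).E)
    (E₃ : Finset α) (h₃ : Disjoint (M.disjointSum (@Matroid.truncate α (Matroid.freeOn (F : Set α))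
      (PLDTruncate.freeOn_finite' F) 2) h).E (E₃ : Set α)) (r p q : ℕ) :
    haveI := PLDTruncate.freeOn_finite' F
    haveI := PLDClosure.disjointSum_finite' _ _ h
    haveI := PLDBridge.disjointSum_freeOn_finite _ E₃ h₃
    ThmN.RLS (PercRepro.Matroid.truncate
      ((M.disjointSum (Matroid.truncate (Matroid.freeOn (F : Set α)) 2) h).disjointSum (Matroid.freeOn (E₃ : Set α)) h₃) r) p q := by
  haveI := PLDTruncate.freeOn_finite' F
  haveI := PLDClosure.disjointSum_finite' _ _ h
  exact PLDBridge.rls_disjointSum_freeOn_of_pld _ E₃ h₃ r p q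
    (pld_disjointSum_triangle M h3 (PLDParExt.pld_of_eRank_le_three M h3) F hF h)

end PLDTriangle

end PercRepro
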